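import Mathlib
import Summits.NavierStokesRegularity.NavierStokesRegularity.Theorems.EulerZoomLiouvillePowerGaugeEulerLiouvilleSelfSimilarLimitSetKill
import Summits.NavierStokesRegularity.NavierStokesRegularity.Theorems.EulerZoomLiouvillePowerGaugeEulerLiouvilleSelfSimilarFiniteNodalSetExclusion
import Literature.Analysis.FluidPDE.SelfSimilarEulerBernoulliLocalMax
import HarnessLib.Audit

/-!
# Rung C1 of the crux `EulerZoomLiouville.PowerGaugeEulerLiouville`: the TOP BAD NODE adherent to the
# vortical region — a non-vortical stagnation point below which all vorticity hangs

Route №10 `EulerZoomLiouville` (NavierStokesRegularity), crux E = stmt-NavierStokesRegularity-19832,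
tenure rung C1 (exactly self-similar members), registered residue `stub_selfSimilarExtremal`.
Second file of the NODAL-CONTINUUM line (lineage ns-typeII-p1, gen 7; no countability hypothesis on the
nodal set).  Setting: `0 < γ < ½`, a `C²` stationary self-similar Euler profile `(U, P)` (CIV 2026
(3.3)) with the far field (3.8); `V = γ(y−c) + U`, `Ω = curl U`, `𝒩_V = {V = 0}`, Bernoulli function
`ℋ = ½|V|² + P + ½γ(γ−1)|y−c|²` (CIV (3.30)), which INCREASES along backward trajectories in the window
(`V·∇ℋ = (2γ−1)|V|²`, (3.31)).  A node `z` is BAD if `⟪DU(z)w, w⟫ ≥ 1` for a unit `w` (all vortical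
nodes are bad, `DU(z)Ω(z) = Ω(z)`); the vortical region is the open invariant set `O = {Ω ≠ 0}`.

* `selfSimilarBernoulli_le_of_mapClusterPt` — `ℋ(Y(0)) ≤ ℋ(z)` at every cluster point `z` of a
  backward trajectory `Y` (monotonicity + continuity);
* `isClosed_badSet` — the bad condition is closed (compactness of the unit sphere);
* `exists_topBadNode` — **THE TOP BAD NODE.**  If `Ω ≢ 0` there is a stagnation point `z♭` with:
  (i) `z♭` is BAD and lies in `closure O` (it is the `ℋ`-maximal such node — the set of bad nodes
  adherent to `O` is compact and, by LIMIT-SET KILL (`exists_badNode_mapClusterPt_of_curl_ne_zero`),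
  nonempty); (ii) **`O ⊆ {ℋ < ℋ(z♭)}`** — every vortical point lies STRICTLY below the Bernoulli
  level of `z♭` (its backward trajectory climbs to a bad node adherent to `O`, and equality would make
  it a local maximum of `ℋ`, i.e. a non-vortical node, tree
  `not_isLocalMax_selfSimilarBernoulli_of_curl_ne_zero`); (iii) hence `z♭ ∈ ∂O` is NON-VORTICAL,
  `Ω(z♭) = 0`, so `DU(z♭)` is the symmetric strain with top eigenvalue `≥ 1`;
* `exists_topBadNode_of_ne_zero` — the same from `U ≢ 0` (harmonic Liouville step).

Compare the Eulerian `exists_nonvortical_inflow_stagnation` (`SelfSimilarEulerBernoulliSaddle`): the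
`ℋ`-top bad node overall, with `Ω ≡ 0` on `{ℋ > ℋ(z)}`.  The Lagrangian refinement here is ADHERENCE:
`z♭ ∈ closure{Ω ≠ 0}` with the strict confinement `{Ω ≠ 0} ⊆ {ℋ < ℋ(z♭)}` — the input of the local
exit analysis at `z♭` in the sequel `…SelfSimilarTopBadNodeHyperbolic` (a hyperbolic `z♭` is impossible).

WHAT THIS IS NOT: not NS, not E, not rung C1 — classical (`C²`) profiles with (3.8); no claim when
`DV(z♭)` is degenerate.  References: P. Constantin, M. Ignatova, V. Vicol, arXiv:2602.17570 (2026),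
§3.4.3 (3.29)–(3.33), §3.5 Thms 3.8, 3.10. [ConstantinIgnatovaVicol2026Putative]
-/

noncomputable section

-- flat `Theorems/<Route><Decl>…` files of one crux share the namespace of the crux (tree convention)
set_option linter.dupNamespace false

open Set Filter Topology Metric Function InnerProductSpace
open scoped RealInnerProductSpace NNReal

namespace Summit.NavierStokesRegularity.NavierStokesRegularity.Theorems.PowerGaugeEulerLiouville.NodalContinuum

open Literature.Analysis Literature.Analysis.FluidPDE Literature.Analysis.ODE
open Summit.NavierStokesRegularity.NavierStokesRegularity.Theorems.PowerGaugeEulerLiouville.NodalFiniteness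

variable {γ C : ℝ} {c : EuclideanSpace ℝ (Fin 3)}
  {U : EuclideanSpace ℝ (Fin 3) → EuclideanSpace ℝ (Fin 3)} {P : EuclideanSpace ℝ (Fin 3) → ℝ}

/-! ### `ℋ` climbs along backward trajectories to its cluster values -/

/-- In the window `γ < ½`, `ℋ ∘ Y` is nondecreasing on `[0, ∞)` along a backward trajectory
`Y' = −V(Y)` (`d/dt ℋ(Y) = (1−2γ)|V(Y)|² ≥ 0`). [cite: ConstantinIgnatovaVicol2026Putative, §3.4.3 eq. (3.31)] -/
theorem monotoneOn_selfSimilarBernoulli_comp (h : IsSelfSimilarEulerProfile γ c U P) (hγ2 : γ < 1 / 2)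
    {Y : ℝ → EuclideanSpace ℝ (Fin 3)}
    (hY : ∀ t, HasDerivAt Y ((-1 : ℝ) • selfSimilarTransport γ c U (Y t)) t) :
    MonotoneOn (fun s => selfSimilarBernoulli γ c U P (Y s)) (Ici 0) := by
  have hd := h.hasDerivAt_bernoulli_comp hY
  refine monotoneOn_of_hasDerivWithinAt_nonneg (convex_Ici 0)
    (fun s _ => (hd s).continuousAt.continuousWithinAt) (fun s _ => (hd s).hasDerivWithinAt) ?_
  intro s _
  have : 0 ≤ (1 - 2 * γ) * ‖selfSimilarTransport γ c U (Y s)‖ ^ 2 :=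
    mul_nonneg (by linarith) (sq_nonneg _)
  linarith

/-- **`ℋ(Y(0)) ≤ ℋ(z)` at every cluster point `z` of a backward trajectory** (`γ < ½`): `ℋ ∘ Y` is
nondecreasing and `ℋ` is continuous. [cite: ConstantinIgnatovaVicol2026Putative, §3.4.3 eq. (3.31)–(3.33)] -/
theorem selfSimilarBernoulli_le_of_mapClusterPt (h : IsSelfSimilarEulerProfile γ c U P) (hγ2 : γ < 1 / 2)
    {Y : ℝ → EuclideanSpace ℝ (Fin 3)}
    (hY : ∀ t, HasDerivAt Y ((-1 : ℝ) • selfSimilarTransport γ c U (Y t)) t)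
    {z : EuclideanSpace ℝ (Fin 3)} (hz : MapClusterPt z atTop Y) :
    selfSimilarBernoulli γ c U P (Y 0) ≤ selfSimilarBernoulli γ c U P z := by
  set Hb := selfSimilarBernoulli γ c U P with hHb
  have hHc : Continuous Hb := h.contDiff_selfSimilarBernoulli.continuous
  have hmono := monotoneOn_selfSimilarBernoulli_comp h hγ2 hY
  by_contra hlt
  push Not at hlt
  have hW : ∀ᶠ y in 𝓝 z, Hb y < Hb (Y 0) := (hHc.tendsto z).eventually (Iio_mem_nhds hlt)
  have hfreq := hz.frequently hW
  obtain ⟨t, ht, ht0⟩ := (hfreq.and_eventually (eventually_ge_atTop 0)).exists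
  have := hmono (mem_Ici.2 le_rfl) (mem_Ici.2 ht0) ht0
  simp only at this
  linarith

/-! ### The bad set is closed; the vortical region is open -/

/-- The BAD condition `∃ w, |w| = 1 ∧ ⟪DU(z)w, w⟫ ≥ 1` defines a closed set (sequential closedness:
extract a convergent subsequence of the unit vectors). [cite: ConstantinIgnatovaVicol2026Putative, §3.5 Def. 3.7 (stretching at stagnation points)] -/
theorem isClosed_badSet (h : IsSelfSimilarEulerProfile γ c U P) :
    IsClosed {z : EuclideanSpace ℝ (Fin 3) |
      ∃ w : EuclideanSpace ℝ (Fin 3), ‖w‖ = 1 ∧ 1 ≤ ⟪fderiv ℝ U z w, w⟫} := by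
  refine IsSeqClosed.isClosed fun zs z hzs hz => ?_
  choose w hw1 hw using hzs
  have hmem : ∀ n, w n ∈ sphere (0 : EuclideanSpace ℝ (Fin 3)) 1 := fun n => by simp [hw1 n]
  obtain ⟨e, he, φ, hφ, hlim⟩ := (isCompact_sphere (0 : EuclideanSpace ℝ (Fin 3)) 1).tendsto_subseq hmem
  have he1 : ‖e‖ = 1 := by simpa using he
  refine ⟨e, he1, ?_⟩
  have hpair : Tendsto (fun n => (zs (φ n), w (φ n))) atTop (𝓝 (z, e)) :=
    (hz.comp hφ.tendsto_atTop).prodMk_nhds hlim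
  have hF := ((continuous_stretchingForm h).tendsto (z, e)).comp hpair
  exact ge_of_tendsto' hF fun n => hw (φ n)

/-- The vortical region `{Ω ≠ 0}` is open. [cite: ConstantinIgnatovaVicol2026Putative, §3.1.1 eq. (3.4)] -/
theorem isOpen_vorticalSet (h : IsSelfSimilarEulerProfile γ c U P) :
    IsOpen {y : EuclideanSpace ℝ (Fin 3) | curl U y ≠ 0} :=
  isOpen_ne_fun h.isSelfSimilarEulerVorticityProfile.differentiable_curl.continuous continuous_const

/-! ### The top bad node adherent to the vortical region -/

/-- **THE TOP BAD NODE.**  Let `0 < γ < ½` and `(U, P)` a `C²` self-similar Euler profile with (3.8) and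
`Ω = curl U ≢ 0`.  Then there is a stagnation point `z♭` of `V = γ(y−c) + U` such that: `z♭` is bad
(`⟪DU(z♭)w, w⟫ ≥ 1` for a unit `w`) and adherent to the vortical region (`z♭ ∈ closure{Ω ≠ 0}`); every
bad node adherent to the vortical region has `ℋ ≤ ℋ(z♭)`; **every vortical point has `ℋ < ℋ(z♭)`**;
and consequently `Ω(z♭) = 0` (`z♭ ∈ ∂{Ω ≠ 0}`).  Proof: maximise the continuous `ℋ` over the compact,
nonempty (LIMIT-SET KILL) set of bad nodes in `closure{Ω ≠ 0}`; a vortical `x` climbs backward to a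
bad node adherent to `{Ω ≠ 0}` (`exists_badNode_mapClusterPt_of_curl_ne_zero`,
`selfSimilarBernoulli_le_of_mapClusterPt`), so `ℋ(x) ≤ ℋ(z♭)`, and equality would make `x` a local
maximum of `ℋ`, impossible at a vortical point (`not_isLocalMax_selfSimilarBernoulli_of_curl_ne_zero`).
[cite: ConstantinIgnatovaVicol2026Putative, §3.4.3–§3.5 (Bernoulli landscape; not in print)] -/
theorem exists_topBadNode (h : IsSelfSimilarEulerProfile γ c U P) (hγ : 0 < γ) (hγ2 : γ < 1 / 2)
    (hfar : HasSelfSimilarFarFieldWith γ c C U) (hne : ∃ x, curl U x ≠ 0) :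
    ∃ z ∈ selfSimilarNodalSet γ c U,
      (∃ w : EuclideanSpace ℝ (Fin 3), ‖w‖ = 1 ∧ 1 ≤ ⟪fderiv ℝ U z w, w⟫) ∧
      z ∈ closure {y | curl U y ≠ 0} ∧
      (∀ z' ∈ selfSimilarNodalSet γ c U, z' ∈ closure {y | curl U y ≠ 0} →
        (∃ w : EuclideanSpace ℝ (Fin 3), ‖w‖ = 1 ∧ 1 ≤ ⟪fderiv ℝ U z' w, w⟫) →
        selfSimilarBernoulli γ c U P z' ≤ selfSimilarBernoulli γ c U P z) ∧
      (∀ x, curl U x ≠ 0 → selfSimilarBernoulli γ c U P x < selfSimilarBernoulli γ c U P z) ∧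
      curl U z = 0 := by
  classical
  have hγ' : γ ≠ 1 / 2 := hγ2.ne
  have hK := lipschitzWith_transport h hγ hfar
  set Hb := selfSimilarBernoulli γ c U P with hHb
  set O : Set (EuclideanSpace ℝ (Fin 3)) := {y | curl U y ≠ 0} with hO
  set Bad : Set (EuclideanSpace ℝ (Fin 3)) :=
    {z | ∃ w : EuclideanSpace ℝ (Fin 3), ‖w‖ = 1 ∧ 1 ≤ ⟪fderiv ℝ U z w, w⟫} with hBad
  set S : Set (EuclideanSpace ℝ (Fin 3)) := selfSimilarNodalSet γ c U ∩ (Bad ∩ closure O) with hS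
  have hSc : IsCompact S :=
    (hfar.isCompact_selfSimilarNodalSet hγ h.contDiff_velocity.continuous).inter_right ((isClosed_badSet h).inter isClosed_closure)
  -- every vortical point climbs to a node of `S`
  have hclimb : ∀ x, curl U x ≠ 0 → ∃ z ∈ S, Hb x ≤ Hb z := by
    intro x hx
    obtain ⟨z, hzN, hcl, hbad, hzcl⟩ := exists_badNode_mapClusterPt_of_curl_ne_zero h hγ hγ' hfar hK hx
    refine ⟨z, ⟨hzN, hbad, hzcl⟩, ?_⟩
    have := selfSimilarBernoulli_le_of_mapClusterPt h hγ2 (hasDerivAt_backwardFlow hK x) hcl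
    simpa only [neg_zero, lipschitzFlow_zero] using this
  have hSne : S.Nonempty := by
    obtain ⟨x, hx⟩ := hne
    obtain ⟨z, hz, -⟩ := hclimb x hx
    exact ⟨z, hz⟩
  have hHc : Continuous Hb := h.contDiff_selfSimilarBernoulli.continuous
  obtain ⟨z, hzS, hmax⟩ := hSc.exists_isMaxOn hSne hHc.continuousOn
  obtain ⟨hzN, hzbad, hzcl⟩ := hzS
  -- (ii): `O ⊆ {ℋ ≤ ℋ z}` and then strictly
  have hle : ∀ x, curl U x ≠ 0 → Hb x ≤ Hb z := by
    intro x hx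
    obtain ⟨z', hz'S, hxz'⟩ := hclimb x hx
    exact hxz'.trans (hmax hz'S)
  have hlt : ∀ x, curl U x ≠ 0 → Hb x < Hb z := by
    intro x hx
    refine lt_of_le_of_ne (hle x hx) fun heq => ?_
    -- `x` would be a local maximum of `ℋ`
    have hlocal : IsLocalMax Hb x := by
      have hOx : O ∈ 𝓝 x := (isOpen_vorticalSet h).mem_nhds hx
      filter_upwards [hOx] with y hy
      rw [heq]
      exact hle y hy
    have hxN : x ∈ selfSimilarNodalSet γ c U :=
      (h.fderiv_selfSimilarBernoulli_eq_zero_iff hγ' x).1 hlocal.fderiv_eq_zero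
    exact h.not_isLocalMax_selfSimilarBernoulli_of_curl_ne_zero hγ' hxN hx hlocal
  have hΩz : curl U z = 0 := by
    by_contra hne'
    exact lt_irrefl _ (hlt z hne')
  exact ⟨z, hzN, hzbad, hzcl, fun z' hz'N hz'cl hz'bad => hmax ⟨hz'N, hz'bad, hz'cl⟩, hlt, hΩz⟩

/-- Under (3.8) an irrotational profile is trivial (incompressible + irrotational ⇒ harmonic with
`DU → 0` at infinity ⇒ constant `= U(c) = 0`). [cite: ConstantinIgnatovaVicol2026Putative, §3.5 proof of Thm 3.10 (last step)] -/
theorem eq_zero_of_forall_curl_eq_zero (h : IsSelfSimilarEulerProfile γ c U P) (hγ : 0 < γ)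
    (hfar : HasSelfSimilarFarFieldWith γ c C U) (hcurl : ∀ x, curl U x = 0) : U = 0 := by
  have hD := hfar.tendsto_norm_fderiv hγ
  funext y
  rw [eq_of_curl_eq_zero_of_isDivFree_of_fderiv_tendsto_zero h.contDiff_velocity hcurl h.divFree hD
    y c, hfar.apply_center]
  rfl

/-- **THE TOP BAD NODE of a nontrivial in-window profile** (`U ≢ 0` instead of `Ω ≢ 0`).
[cite: ConstantinIgnatovaVicol2026Putative, §3.4.3–§3.5 (Bernoulli landscape; not in print)] -/
theorem exists_topBadNode_of_ne_zero (h : IsSelfSimilarEulerProfile γ c U P) (hγ : 0 < γ)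
    (hγ2 : γ < 1 / 2) (hfar : HasSelfSimilarFarFieldWith γ c C U) (hU : U ≠ 0) :
    ∃ z ∈ selfSimilarNodalSet γ c U,
      (∃ w : EuclideanSpace ℝ (Fin 3), ‖w‖ = 1 ∧ 1 ≤ ⟪fderiv ℝ U z w, w⟫) ∧
      z ∈ closure {y | curl U y ≠ 0} ∧
      (∀ z' ∈ selfSimilarNodalSet γ c U, z' ∈ closure {y | curl U y ≠ 0} →
        (∃ w : EuclideanSpace ℝ (Fin 3), ‖w‖ = 1 ∧ 1 ≤ ⟪fderiv ℝ U z' w, w⟫) →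
        selfSimilarBernoulli γ c U P z' ≤ selfSimilarBernoulli γ c U P z) ∧
      (∀ x, curl U x ≠ 0 → selfSimilarBernoulli γ c U P x < selfSimilarBernoulli γ c U P z) ∧
      curl U z = 0 := by
  refine exists_topBadNode h hγ hγ2 hfar ?_
  by_contra hall
  push Not at hall
  exact hU (eq_zero_of_forall_curl_eq_zero h hγ hfar hall)

end Summit.NavierStokesRegularity.NavierStokesRegularity.Theorems.PowerGaugeEulerLiouville.NodalContinuum
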